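/-
Copyright: derived here (Resolution Observatory cell `pub-rosobs`, carver gen 57). AI-written Lean; AI review is weaker than expert
review.  Companion file of the cell's POLYNOMIAL weighted-centre model `W(f)`: the ORDER-`k` COMPONENTS of a triple composite of
substitutions — the expansion "`f∘Θ = Σ λ₁^i λ₂^j λ₃^l τ^{i+j+l} E_l E_j E_i f`" of engine 1's LEMMA FC (B5) — identified with
`FermatComposition.orderComp`, so that `Θ = id` feeds the word induction (THEOREM-FC-eng1-g37 §1 OPERATORS, §4 (B5), §7 (4)).
Instrument — NOT a resolution theorem and NOT a statement about the invariant of [AbramovichTemkinWlodarczyk2024].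
-/
import Literature.AlgebraicGeometry.Resolution.WeightedCentreFermatComposition
import Literature.AlgebraicGeometry.Resolution.WeightedCentreEvenReparam
import Mathlib.Algebra.Polynomial.Coeff
import Mathlib.Algebra.Polynomial.Inductions
import Mathlib.Algebra.BigOperators.Group.Finset.Sigma
import Mathlib.RingTheory.Ideal.Span
import HarnessLib

/-!
# Order-`k` components of a triple composite of substitutions = `FermatComposition.orderComp`

Uniform value line: INSTRUMENT — kernel-checked bookkeeping for the polynomial weighted-centre model `W(f)` of the cell
(engine 1's toy model: THEOREM-FC-eng1-g37 §4 (B5)) — NOT a resolution theorem, NOT a statement about the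
Abramovich–Temkin–Włodarczyk invariant, NOT summit progress; AI-written Lean, AI review is weaker than expert review.

Setting: `A₀` a commutative ring (cell: `R[ε]`, `R = k⟦s⟧`), substitutions = ring endomorphisms `Φ` of `A₀[σ]` with `Φ σ = σ`.
* `compCoeff Φ n : A₀ →+ A₀`, `a ↦ (Φ (C a)).coeff n` — the engine's OPERATORS `E_n` (`Φ(f) = Σ_n σ^n E_n f` on `A₀`);
  `E_0 = id` when `Φ ≡ id (mod σ)` (`compCoeff_zero_eq_id`); `E_n (c·a) = c·E_n a` for `Φ`-fixed constants `c`.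
* `coeff_map_eq_sum_antidiagonal`: `(Ψ g)_k = Σ_{i+j=k} E^Ψ_j (g_i)` for `Ψ σ = σ` (one substitution applied to a polynomial);
* `coeff_comp_comp_C`: for three substitutions, `((Ψ₂ ∘ Ψ₁ ∘ Ψ₀)(C f))_k = Σ_{i+j=k} Σ_{a+b=i} E²_j (E¹_b (E⁰_a f))`;
* `sum_antidiagonalTuple_three`: the re-indexing `Σ_{x : Fin 3 → ℕ, Σ x = k} φ x = Σ_{i+j=k} Σ_{a+b=i} φ (a, b, j)`;
* **`coeff_comp_comp_C_eq_orderComp`** (engine §4 (B5) "f∘Θ = Σ λ₁^i λ₂^j λ₃^l τ^{i+j+l} E_l E_j E_i f"): if the three factors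
  are RESCALINGS of one `Φ` by `Φ`-fixed constants `l = (l₀, l₁, l₂)` in the sense `(Ψ_b (C a))_n = l_b^n · (Φ (C a))_n`
  (this is `rescaleHom (l b) Φ` of `WeightedCentreSigmaRescaling`, by `rescaleHom_C` + `coeff_sigmaScale`), then
  `((Ψ₂ ∘ Ψ₁ ∘ Ψ₀)(C f))_k = orderComp (compCoeff Φ) l id k f` — the order convention of `FermatComposition.word`
  (`E_{x 2} ∘ E_{x 1} ∘ E_{x 0}`) is: `x 0` = innermost factor `Ψ₀`;
* hence `Θ := Ψ₂ ∘ Ψ₁ ∘ Ψ₀ = id` gives the relations `(E_k)`: `orderComp … k f = 0` for `k ≥ 1`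
  (`orderComp_eq_zero_of_comp_eq_id`), and with `u_k = Σ_b l_b^k` regular on `A₀` for `k ∉ mℕ` the word induction
  `FermatComposition.map_eq_zero_of_orderComp_eq_zero_self` yields `E_k = 0` for `k ∉ mℕ`, i.e. `Φ (C f) ∈ A₀[σ^m]`
  (`compCoeff_eq_zero_of_comp_eq_id`, `map_C_eq_expand_contract`) — LEMMA FC (B5)–(B6) up to the model-level input `Θ = id` (B4).

What is NOT here (engine 1's modelling): the rescalings themselves (`WeightedCentreSigmaRescaling`), the branch `t(s)` and
`u_k ≠ 0` (`WeightedCentreFermatBranch`), LEMMA CP / PR″, the hypotheses (H1)/(H>)/(Hmax) and (B4) `Θ = id`.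

Pattern cites: words in the components of a higher derivation / substitution [cite: Matsumura1987, §27 (pp. 207–209)]; coefficient
bookkeeping [cite: Lang2002, Ch. IV §1].  Formalisation and statements ours, elementary.
-/

namespace Literature.AlgebraicGeometry.Resolution.WeightedBlowup

open Polynomial

section Operators

variable {A₀ : Type*} [CommRing A₀]

/-- The **component operators** `E_n : a ↦ (Φ (C a))_n` of a substitution `Φ` (construction, ours; engine §1 OPERATORS).
[cite: Matsumura1987, §27 (pp. 207–209)] -/
noncomputable def compCoeff (Φ : A₀[X] →+* A₀[X]) (n : ℕ) : A₀ →+ A₀ where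
  toFun a := (Φ (C a)).coeff n
  map_zero' := by rw [map_zero, map_zero, coeff_zero]
  map_add' a b := by rw [map_add, map_add, coeff_add]

/-- Unfolding (plumbing). [cite: Matsumura1987, §27 (pp. 207–209)] -/
@[simp] theorem compCoeff_apply (Φ : A₀[X] →+* A₀[X]) (n : ℕ) (a : A₀) : compCoeff Φ n a = (Φ (C a)).coeff n := rfl

/-- `E_0 = id` for `Φ ≡ id (mod σ)` (ours, bookkeeping). [cite: Matsumura1987, §27 (pp. 207–209)] -/
theorem compCoeff_zero_eq_id {Φ : A₀[X] →+* A₀[X]} (hΦ : ∀ f, Φ f - f ∈ Ideal.span {(X : A₀[X])}) :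
    compCoeff Φ 0 = AddMonoidHom.id A₀ := by
  ext a
  obtain ⟨g, hg⟩ := Ideal.mem_span_singleton'.mp (hΦ (C a))
  have h := congr_arg (fun q : A₀[X] => q.coeff 0) hg
  simp only [coeff_mul_X_zero, coeff_sub, coeff_C_zero] at h
  rw [compCoeff_apply, AddMonoidHom.id_apply]
  exact (sub_eq_zero.mp h.symm)

/-- `E_n (c · a) = c · E_n a` for a `Φ`-fixed constant `c` (ours, bookkeeping). [cite: Matsumura1987, §27 (pp. 207–209)] -/
theorem compCoeff_mul_of_map_C {Φ : A₀[X] →+* A₀[X]} {c : A₀} (hc : Φ (C c) = C c) (n : ℕ) (a : A₀) :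
    compCoeff Φ n (c * a) = c * compCoeff Φ n a := by
  rw [compCoeff_apply, compCoeff_apply, map_mul, map_mul, hc, coeff_C_mul]

/-- Powers of fixed constants are fixed (plumbing). [cite: Lang2002, Ch. IV §1] -/
theorem map_C_pow_of_map_C {Φ : A₀[X] →+* A₀[X]} {c : A₀} (hc : Φ (C c) = C c) (n : ℕ) : Φ (C (c ^ n)) = C (c ^ n) := by
  rw [map_pow, map_pow, hc]

/-! ## One substitution applied to a polynomial -/

/-- **`(Ψ g)_k = Σ_{i+j=k} E^Ψ_j (g_i)`** for `Ψ σ = σ` (ours, bookkeeping: `Ψ (Σ_i g_i σ^i) = Σ_i Ψ(C g_i) σ^i`).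
[cite: Matsumura1987, §27 (pp. 207–209)] -/
theorem coeff_map_eq_sum_antidiagonal (Ψ : A₀[X] →+* A₀[X]) (hX : Ψ X = X) (g : A₀[X]) (k : ℕ) :
    (Ψ g).coeff k = ∑ ij ∈ Finset.antidiagonal k, compCoeff Ψ ij.2 (g.coeff ij.1) := by
  induction g using Polynomial.induction_on' with
  | add p q hp hq => simp only [map_add, coeff_add, hp, hq, Finset.sum_add_distrib]
  | monomial n a =>
    rw [← C_mul_X_pow_eq_monomial, map_mul, map_pow, hX, coeff_mul_X_pow']
    simp_rw [coeff_C_mul_X_pow]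
    split_ifs with hnk
    · rw [Finset.sum_eq_single_of_mem (n, k - n) (Finset.mem_antidiagonal.mpr (Nat.add_sub_cancel' hnk))]
      · rw [if_pos rfl, compCoeff_apply]
      · intro ij hij hne
        rw [Finset.mem_antidiagonal] at hij
        have h1 : ij.1 ≠ n := fun h1 => hne (Prod.ext h1 (by simp only; omega))
        rw [if_neg h1, map_zero]
    · refine (Finset.sum_eq_zero fun ij hij => ?_).symm
      rw [Finset.mem_antidiagonal] at hij
      have h1 : ij.1 ≠ n := fun h1 => hnk (by omega)
      rw [if_neg h1, map_zero]

/-! ## Three substitutions -/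

/-- **`((Ψ₂ ∘ Ψ₁ ∘ Ψ₀)(C f))_k = Σ_{i+j=k} Σ_{a+b=i} E²_j (E¹_b (E⁰_a f))`** (ours; `Ψ₁ σ = Ψ₂ σ = σ`).
[cite: Matsumura1987, §27 (pp. 207–209)] -/
theorem coeff_comp_comp_C (Ψ₀ Ψ₁ Ψ₂ : A₀[X] →+* A₀[X]) (h1 : Ψ₁ X = X) (h2 : Ψ₂ X = X) (f : A₀) (k : ℕ) :
    ((Ψ₂.comp (Ψ₁.comp Ψ₀)) (C f)).coeff k =
      ∑ ij ∈ Finset.antidiagonal k, ∑ ab ∈ Finset.antidiagonal ij.1,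
        compCoeff Ψ₂ ij.2 (compCoeff Ψ₁ ab.2 (compCoeff Ψ₀ ab.1 f)) := by
  rw [RingHom.comp_apply, RingHom.comp_apply, coeff_map_eq_sum_antidiagonal Ψ₂ h2]
  refine Finset.sum_congr rfl fun ij _ => ?_
  rw [coeff_map_eq_sum_antidiagonal Ψ₁ h1, map_sum]
  rfl

/-- Re-indexing `Σ_{x : Fin 3 → ℕ, Σ x = k} φ x = Σ_{i+j=k} Σ_{a+b=i} φ (a, b, j)` (ours, bookkeeping). [cite: Lang2002, Ch. IV §1] -/
theorem sum_antidiagonalTuple_three {β : Type*} [AddCommMonoid β] (φ : (Fin 3 → ℕ) → β) (k : ℕ) :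
    ∑ x ∈ Finset.Nat.antidiagonalTuple 3 k, φ x =
      ∑ ij ∈ Finset.antidiagonal k, ∑ ab ∈ Finset.antidiagonal ij.1, φ ![ab.1, ab.2, ij.2] := by
  rw [Finset.sum_sigma' (Finset.antidiagonal k) (fun ij => Finset.antidiagonal ij.1) fun ij ab => φ ![ab.1, ab.2, ij.2]]
  symm
  refine Finset.sum_nbij' (fun s => ![s.2.1, s.2.2, s.1.2]) (fun x => (⟨(x 0 + x 1, x 2), (x 0, x 1)⟩ : Σ _ : ℕ × ℕ, ℕ × ℕ))
    ?_ ?_ ?_ ?_ (fun _ _ => rfl)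
  · rintro ⟨⟨i, j⟩, ⟨a, b⟩⟩ hs
    simp only [Finset.mem_sigma, Finset.mem_antidiagonal] at hs
    rw [Finset.Nat.mem_antidiagonalTuple, Fin.sum_univ_three]
    simp only [Matrix.cons_val_zero, Matrix.cons_val_one, Matrix.cons_val_two, Matrix.tail_cons, Matrix.head_cons]
    omega
  · intro x hx
    rw [Finset.Nat.mem_antidiagonalTuple, Fin.sum_univ_three] at hx
    simp only [Finset.mem_sigma, Finset.mem_antidiagonal]
    exact ⟨hx, trivial⟩
  · rintro ⟨⟨i, j⟩, ⟨a, b⟩⟩ hs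
    simp only [Finset.mem_sigma, Finset.mem_antidiagonal] at hs
    simp only [Matrix.cons_val_zero, Matrix.cons_val_one, Matrix.cons_val_two, Matrix.tail_cons, Matrix.head_cons, hs.2]
  · intro x _
    ext i
    fin_cases i <;> rfl

/-- A rescaled factor pulls powers of its constant out (plumbing). [cite: Lang2002, Ch. IV §1] -/
theorem compCoeff_pow_mul {Φ : A₀[X] →+* A₀[X]} (l : Fin 3 → A₀) (hΦl : ∀ b, Φ (C (l b)) = C (l b)) (b : Fin 3) (e n : ℕ)
    (a : A₀) : compCoeff Φ n (l b ^ e * a) = l b ^ e * compCoeff Φ n a :=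
  compCoeff_mul_of_map_C (map_C_pow_of_map_C (hΦl b) e) n a

/-- **The order-`k` component of the triple composite is `orderComp`** (ours; engine §4 (B5)
"`f∘Θ = Σ λ₁^i λ₂^j λ₃^l τ^{i+j+l} E_l E_j E_i f`"): `Φ σ = σ`-type substitutions `Ψ₀, Ψ₁, Ψ₂` that are RESCALINGS of `Φ` by
`Φ`-fixed constants `l_b` (`(Ψ_b (C a))_n = l_b^n (Φ (C a))_n`) satisfy
`((Ψ₂ ∘ Ψ₁ ∘ Ψ₀)(C f))_k = orderComp (compCoeff Φ) l id k f` (word order: `x 0` ↔ the innermost factor `Ψ₀`).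
[cite: Matsumura1987, §27 (pp. 207–209)] -/
theorem coeff_comp_comp_C_eq_orderComp (Φ : A₀[X] →+* A₀[X]) (Ψ : Fin 3 → (A₀[X] →+* A₀[X])) (l : Fin 3 → A₀)
    (hX : ∀ b, Ψ b X = X) (hΦl : ∀ b, Φ (C (l b)) = C (l b))
    (hE : ∀ b n a, ((Ψ b) (C a)).coeff n = l b ^ n * (Φ (C a)).coeff n) (f : A₀) (k : ℕ) :
    (((Ψ 2).comp ((Ψ 1).comp (Ψ 0))) (C f)).coeff k =
      FermatComposition.orderComp (compCoeff Φ) l (AddMonoidHom.id A₀) k f := by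
  rw [coeff_comp_comp_C _ _ _ (hX 1) (hX 2), FermatComposition.orderComp, sum_antidiagonalTuple_three]
  refine Finset.sum_congr rfl fun ij _ => Finset.sum_congr rfl fun ab _ => ?_
  have hE' : ∀ b n a, compCoeff (Ψ b) n a = l b ^ n * compCoeff Φ n a := fun b n a => by
    rw [compCoeff_apply, compCoeff_apply, hE]
  simp only [FermatComposition.mono, FermatComposition.word_apply, Fin.prod_univ_three, Matrix.cons_val_zero,
    Matrix.cons_val_one, Matrix.cons_val_two, Matrix.tail_cons, Matrix.head_cons, AddMonoidHom.id_apply, smul_eq_mul, hE',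
    compCoeff_pow_mul l hΦl]
  ring

/-- **`Θ = id` ⇒ the relations `(E_k)`** (ours; engine §4 (B5)): under the hypotheses of `coeff_comp_comp_C_eq_orderComp`,
`Ψ₂ ∘ Ψ₁ ∘ Ψ₀ = id` gives `orderComp (compCoeff Φ) l id k f = 0` for every `k ≥ 1`. [cite: Matsumura1987, §27 (pp. 207–209)] -/
theorem orderComp_eq_zero_of_comp_eq_id (Φ : A₀[X] →+* A₀[X]) (Ψ : Fin 3 → (A₀[X] →+* A₀[X])) (l : Fin 3 → A₀)
    (hX : ∀ b, Ψ b X = X) (hΦl : ∀ b, Φ (C (l b)) = C (l b))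
    (hE : ∀ b n a, ((Ψ b) (C a)).coeff n = l b ^ n * (Φ (C a)).coeff n)
    (hΘ : (Ψ 2).comp ((Ψ 1).comp (Ψ 0)) = RingHom.id _) {k : ℕ} (hk : 0 < k) (f : A₀) :
    FermatComposition.orderComp (compCoeff Φ) l (AddMonoidHom.id A₀) k f = 0 := by
  rw [← coeff_comp_comp_C_eq_orderComp Φ Ψ l hX hΦl hE, hΘ, RingHom.id_apply, coeff_C, if_neg hk.ne']

/-- **LEMMA FC (B5), typed core** (ours): `Φ ≡ id (mod σ)`, `Ψ_b` the rescalings of `Φ` by `Φ`-fixed constants `l_b` as above,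
`Θ = Ψ₂ ∘ Ψ₁ ∘ Ψ₀ = id`, and the power sums `u_k = Σ_b l_b^k` regular on `A₀` for `k ∉ mℕ` (cell: `u_k ≠ 0` in the domain
`k⟦s⟧`, `A₀ = k⟦s⟧[ε]` — `WeightedCentreFermatBranch`) ⇒ `E_k = 0` for every `k ∉ mℕ`. [cite: Matsumura1987, §27 (pp. 207–209)] -/
theorem compCoeff_eq_zero_of_comp_eq_id (Φ : A₀[X] →+* A₀[X]) (hΦ : ∀ f, Φ f - f ∈ Ideal.span {(X : A₀[X])})
    (Ψ : Fin 3 → (A₀[X] →+* A₀[X])) (l : Fin 3 → A₀) (hX : ∀ b, Ψ b X = X) (hΦl : ∀ b, Φ (C (l b)) = C (l b))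
    (hE : ∀ b n a, ((Ψ b) (C a)).coeff n = l b ^ n * (Φ (C a)).coeff n)
    (hΘ : (Ψ 2).comp ((Ψ 1).comp (Ψ 0)) = RingHom.id _) {m : ℕ}
    (hu : ∀ k, ¬ m ∣ k → IsSMulRegular A₀ (FermatComposition.powerSum l k)) :
    ∀ k, ¬ m ∣ k → compCoeff Φ k = 0 :=
  FermatComposition.map_eq_zero_of_orderComp_eq_zero_self (compCoeff_zero_eq_id hΦ)
    (fun _ hmk f => orderComp_eq_zero_of_comp_eq_id Φ Ψ l hX hΦl hE hΘ
      (Nat.pos_of_ne_zero (by rintro rfl; exact hmk (dvd_zero m))) f) hu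

/-- **… so `Φ (C f) ∈ A₀[σ^m]`** (LEMMA FC (B6) input, ours): under the same hypotheses with `m ≠ 0`, every `Φ (C f)` is a
polynomial in `σ^m`: `Φ (C f) = expand m (contract m (Φ (C f)))`. [cite: Matsumura1987, §27 (pp. 207–209)] -/
theorem map_C_eq_expand_contract (Φ : A₀[X] →+* A₀[X]) (hΦ : ∀ f, Φ f - f ∈ Ideal.span {(X : A₀[X])})
    (Ψ : Fin 3 → (A₀[X] →+* A₀[X])) (l : Fin 3 → A₀) (hX : ∀ b, Ψ b X = X) (hΦl : ∀ b, Φ (C (l b)) = C (l b))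
    (hE : ∀ b n a, ((Ψ b) (C a)).coeff n = l b ^ n * (Φ (C a)).coeff n)
    (hΘ : (Ψ 2).comp ((Ψ 1).comp (Ψ 0)) = RingHom.id _) {m : ℕ} (hm : m ≠ 0)
    (hu : ∀ k, ¬ m ∣ k → IsSMulRegular A₀ (FermatComposition.powerSum l k)) (f : A₀) :
    expand A₀ m (contract m (Φ (C f))) = Φ (C f) :=
  expand_contract_of_coeff hm fun n hmn => by
    rw [← compCoeff_apply, compCoeff_eq_zero_of_comp_eq_id Φ hΦ Ψ l hX hΦl hE hΘ hu n hmn, AddMonoidHom.zero_apply]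

end Operators

end Literature.AlgebraicGeometry.Resolution.WeightedBlowup
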